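import Summits.Ventures.CertifiedArithmetic.LowPrec.SRDyadicThresholds
import Summits.Ventures.CertifiedArithmetic.LowPrec.SRCertificatesFP4InnerProduct
import HarnessLib

/-!
# Inner products under limited-randomness SR: bit thresholds, and product rounding lowers them

HONEST FRAMING: certified error envelopes and provably optimal rounding/accumulation schemes for
low-precision formats under stated cost models; every table by two implementations; no hardware or
vendor claims.

File LXXVIII of the SR slice.  `SRDyadicThresholds` (LXXVII) showed that an `N`-bit IEEE P3109 rule
(`StochasticA/B/C`) reproduces the exact-SR law of a WHOLE computation as soon as every up-probability
the computation can meet is an `N`-bit dyadic, and certified the thresholds for sums (FP4 pairs: two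
bits), counters and one EMA.  Here: INNER PRODUCTS `∑ xₖyₖ` of format vectors, with exact products
`cₖ = xₖyₖ` (elements of the product set `P = F·F`, e.g. `FP4.e2m1Products`, 37 values), in the two
cost models of the slice:

* ONE-STAGE  `ŝₖ₊₁ = SR_N(ŝₖ + cₖ)` (the exact product enters the accumulation; `accExpQ`), and any
  summation TREE whose leaves are exact products (`treeExpQ` with `LeavesIn P`);
* TWO-STAGE  `ŝₖ₊₁ = SR_N(ŝₖ + SR_N(cₖ))` (the product is first SR-rounded into the format, then
  accumulated by a fresh SR; the model `ipExp` of `SRInnerProduct`, here with an `N`-bit rule: `ipExpQ`).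

Generic (any field, any finite format `F ⊆ G`):
* `allOut_mem_sup_of_leavesIn`, `dyadicT_of_pairs_sup`, `treeExpQ_eq_treeExp_of_pairs_sup` — a pair
  table over a SUPERSET `G ⊇ F` of leaf values (exact products) makes every tree with leaves in `G`
  dyadic, hence exact in law under any rule fixing the `N`-bit dyadics;
* `ipExpQ`, `ipExpQ_of_id`, `ipExpQ_eq_ipExp_of_tables` — two-stage: a PRODUCT table
  (`Dyadic N (pUp F cₖ)`) and the format PAIR table give `ipExpQ = ipExp` from every format start, for
  every length and every test function.

FP4 kernel thresholds (`decide`), all sharp: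
* `e2m1Products_dyadic_two` (37 products; `9/4` is not 1-dyadic) ⇒ `e2m1_twoBits_ip_exact`:
  **two random bits reproduce the exact two-stage FP4 inner product in law** (every length, every start,
  `A`, `B`, `C`, any `N ≥ 2`); one bit does not: `e2m1_oneBit_ip_witness` (product `9/4` from `0`:
  means `2 ∣ 5/2 ∣ 2` against `9/4`);
* `e2m1Products_pairs_dyadic_three` (1369 pairs of products; `4 + 1/4` is not 2-dyadic) ⇒
  `e2m1_threeBits_dotTree_exact` (every summation tree with exact-product leaves, any order) and
  `e2m1_threeBits_ip1_exact` (one-stage accumulation, every length and start): **three bits** for the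
  one-stage model, and two do not suffice: `e2m1_twoBits_ip1_witness` (`4 + 1/4`: means `4 ∣ 9/2 ∣ 4`
  against `17/4`) — while the two-stage model IS exact there (`e2m1_twoBits_ip2_at_witness`).
So in FP4, ROUNDING THE PRODUCT FIRST LOWERS THE EXACTNESS THRESHOLD from three bits to two (at the
price of the extra product-rounding variance of `SRInnerProduct.ipVar`).  Lower-bound witnesses for
FP6: `e3m2_ip_threshold_witnesses` (one-stage E3M2 needs ten bits: `-28 + 1/256`; its products four:
`-49/256`), `e2m3_ip_threshold_witnesses` (one-stage E2M3 needs five: `-15/2 + 1/64`; products four).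
= HOME `certs/sr/gen15/ipthr` (families PROD / IP1 / DOTPAIRS on E2M1, E3M2, E2M3 by two
implementations: one-stage thresholds 3 / 10 / 5, two-stage `max(PROD, PAIRS)` = 2 / 6 / 4).
-/

namespace Summit.Ventures.CertifiedArithmetic.LowPrec.SR.LimitedBits

open Literature.ComputerArithmetic.P3109
open Literature.ComputerArithmetic.ConnollyHighamMary2021
open Summit.Ventures.CertifiedArithmetic.LowPrec.SR
open Finset STree

section Generic

variable {K : Type*} [Field K] [LinearOrder K] [IsStrictOrderedRing K] [FloorRing K]

/-! ### Trees whose leaves lie in a superset of the format -/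

omit [IsStrictOrderedRing K] [FloorRing K] in
/-- With leaves in `G ⊇ F`, every possible value of a subtree lies in `G` (a leaf is in `G`; a rounded
node is a format value). -/
theorem allOut_mem_sup_of_leavesIn {F G : Finset K} (hF : F.Nonempty) (hFG : F ⊆ G) :
    ∀ T : STree K, LeavesIn G T → AllOut F T (fun v => v ∈ G)
  | .leaf _, h => h
  | .node l r, _ => allOut_mono F (.node l r) (fun _ hv => hFG hv) (allOut_mem_node F hF l r)

omit [IsStrictOrderedRing K] [FloorRing K] in
/-- **Pair table over a superset of the leaves ⇒ every tree is dyadic.** -/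
theorem dyadicT_of_pairs_sup {F G : Finset K} (hF : F.Nonempty) (hFG : F ⊆ G) {N : ℕ}
    (hp : ∀ a ∈ G, ∀ b ∈ G, Dyadic N (pUp F (a + b))) :
    ∀ T : STree K, LeavesIn G T → DyadicT F N T
  | .leaf _, _ => trivial
  | .node l r, ⟨hl, hr⟩ => ⟨dyadicT_of_pairs_sup hF hFG hp l hl, dyadicT_of_pairs_sup hF hFG hp r hr,
      allOut_mono F l (fun a ha => allOut_mono F r (fun b hb => hp a ha b hb)
        (allOut_mem_sup_of_leavesIn hF hFG r hr)) (allOut_mem_sup_of_leavesIn hF hFG l hl)⟩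

omit [IsStrictOrderedRing K] [FloorRing K] in
/-- Hence any rule fixing the `N`-bit dyadics gives the exact-SR tree model for every tree with leaves
in `G` (e.g. exact products) and every test function. -/
theorem treeExpQ_eq_treeExp_of_pairs_sup {F G : Finset K} (hF : F.Nonempty) (hFG : F ⊆ G)
    {q : K → K} {N : ℕ} (hq : ∀ η, Dyadic N η → q η = η)
    (hp : ∀ a ∈ G, ∀ b ∈ G, Dyadic N (pUp F (a + b))) (T : STree K) (hT : LeavesIn G T)
    (f : K → K) : treeExpQ F q T f = treeExp F T f :=
  treeExpQ_eq_treeExp_of_dyadicT F hq T f (dyadicT_of_pairs_sup hF hFG hp T hT)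

/-! ### The two-stage inner product under an `N`-bit rule -/

/-- One two-stage step under the rule `q`: `E[f(SR_q(s + SR_q(c)))]`. -/
def ipStepQ (F : Finset K) (q : K → K) (s c : K) (f : K → K) : K :=
  stepQ F q c (fun a => stepQ F q (s + a) f)

/-- `ipExpQ F q c n f s = E[f(ŝₙ)]` for `ŝ₀ = s`, `ŝₖ₊₁ = SR_q(ŝₖ + SR_q(cₖ))`. -/
def ipExpQ (F : Finset K) (q : K → K) : (ℕ → K) → ℕ → (K → K) → K → K
  | _, 0, f, s => f s
  | c, n + 1, f, s => ipStepQ F q s (c 0) (ipExpQ F q (fun i => c (i + 1)) n f)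

omit [IsStrictOrderedRing K] [FloorRing K] in
/-- Unfolding, zero steps. -/
@[simp] theorem ipExpQ_zero (F : Finset K) (q : K → K) (c : ℕ → K) (f : K → K) (s : K) :
    ipExpQ F q c 0 f s = f s := rfl

omit [IsStrictOrderedRing K] [FloorRing K] in
/-- Unfolding, one more step. -/
theorem ipExpQ_succ (F : Finset K) (q : K → K) (c : ℕ → K) (n : ℕ) (f : K → K) (s : K) :
    ipExpQ F q c (n + 1) f s = ipStepQ F q s (c 0) (ipExpQ F q (fun i => c (i + 1)) n f) := rfl

omit [IsStrictOrderedRing K] [FloorRing K] in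
/-- The exact rule recovers the two-stage SR model `ipExp` of `SRInnerProduct`. -/
theorem ipExpQ_of_id (F : Finset K) {q : K → K} (hq : ∀ η, q η = η) (c : ℕ → K) (n : ℕ)
    (f : K → K) (s : K) : ipExpQ F q c n f s = ipExp F c n f s := by
  induction n generalizing c s with
  | zero => rfl
  | succ n ih =>
      simp only [ipExpQ, ipExp, ipStepQ, ipStep, stepQ_of_id F hq]
      exact step_congr F _ (step_congr F _ (ih _ _) (ih _ _)) (step_congr F _ (ih _ _) (ih _ _))

omit [IsStrictOrderedRing K] [FloorRing K] in
/-- **Two-stage threshold theorem.** If every product has an `N`-dyadic up-probability (PRODUCT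
table) and every sum of two format values has one (PAIR table), then any rule fixing the `N`-bit
dyadics reproduces the exact two-stage SR inner product from every format start, for every length
and every test function. -/
theorem ipExpQ_eq_ipExp_of_tables {F : Finset K} (hF : F.Nonempty) {q : K → K} {N : ℕ}
    (hq : ∀ η, Dyadic N η → q η = η) {c : ℕ → K} (hP : ∀ k, Dyadic N (pUp F (c k)))
    (hS : ∀ a ∈ F, ∀ b ∈ F, Dyadic N (pUp F (a + b))) {s : K} (hs : s ∈ F) (n : ℕ)
    (f : K → K) : ipExpQ F q c n f s = ipExp F c n f s := by
  induction n generalizing c s with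
  | zero => rfl
  | succ n ih =>
      simp only [ipExpQ, ipExp, ipStepQ, ipStep]
      rw [stepQ_eq_step_of_dyadic F hq _ _ (hP 0)]
      refine step_congr F _ ?_ ?_
      · rw [stepQ_eq_step_of_dyadic F hq _ _ (hS s hs _ (up_mem hF _))]
        exact step_congr F _ (ih (fun k => hP (k + 1)) (up_mem hF _))
          (ih (fun k => hP (k + 1)) (dn_mem hF _))
      · rw [stepQ_eq_step_of_dyadic F hq _ _ (hS s hs _ (dn_mem hF _))]
        exact step_congr F _ (ih (fun k => hP (k + 1)) (up_mem hF _))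
          (ih (fun k => hP (k + 1)) (dn_mem hF _))

omit [IsStrictOrderedRing K] [FloorRing K] in
/-- **One-stage threshold theorem (accumulation of exact products).** A table over format state ×
increment gives `accExpQ = accExp` for every length, from every format start. -/
theorem accExpQ_eq_accExp_of_table {F G : Finset K} (hF : F.Nonempty) {q : K → K} {N : ℕ}
    (hq : ∀ η, Dyadic N η → q η = η) {c : ℕ → K} (hc : ∀ k, c k ∈ G)
    (hT : ∀ s ∈ F, ∀ p ∈ G, Dyadic N (pUp F (s + p))) {s : K} (hs : s ∈ F) (n : ℕ) (f : K → K) :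
    accExpQ F q c n f s = accExp F c n f s := by
  rw [accExpQ_eq_recExpQ, accExp_eq_recExp]
  exact recExpQ_eq_recExp_of_forall_mem hF hq (fun k x hx => hT x hx _ (hc k)) hs n f

end Generic

/-! ### FP4 kernel thresholds -/

section FP4Thresholds

open FP4

/-- Every E2M1 value is a product of two E2M1 values (`x = x·1`). -/
theorem e2m1_subset_products : e2m1 ⊆ e2m1Products :=
  fun x hx => by simpa using mul_mem_e2m1Products hx (show (1 : ℚ) ∈ e2m1 by decide +kernel)

/-- **PRODUCT TABLE (37 entries, kernel decision).** Every product of two E2M1 values has a 2-dyadic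
up-probability in E2M1 (`θ ∈ {0, ¼, ½, ¾}`); `9/4 = (3/2)²` is not 1-dyadic. -/
theorem e2m1Products_dyadic_two :
    (∀ p ∈ e2m1Products, Dyadic 2 (pUp e2m1 p)) ∧ ¬ Dyadic 1 (pUp e2m1 (9/4 : ℚ)) := by
  refine ⟨by decide +kernel, by decide +kernel⟩

/-- **Two random bits reproduce the exact two-stage FP4 inner product in law**: for products of E2M1
values (any sequence in `e2m1Products`), every length `n`, every E2M1 start and every test function,
under `StochasticA`, `B`, `C` with any `N ≥ 2` bits. -/
theorem e2m1_twoBits_ip_exact {N : ℕ} (hN : 2 ≤ N) {c : ℕ → ℚ} (hc : ∀ k, c k ∈ e2m1Products)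
    {s : ℚ} (hs : s ∈ e2m1) (n : ℕ) (f : ℚ → ℚ) :
    ipExpQ e2m1 (probAwayA N) c n f s = ipExp e2m1 c n f s ∧
    ipExpQ e2m1 (probAwayB N) c n f s = ipExp e2m1 c n f s ∧
    ipExpQ e2m1 (probAwayC N) c n f s = ipExp e2m1 c n f s := by
  obtain ⟨hA, hB, hC⟩ := probAwayABC_of_dyadic_le (K := ℚ) hN
  have hP : ∀ k, Dyadic 2 (pUp e2m1 (c k)) := fun k => e2m1Products_dyadic_two.1 _ (hc k)
  exact ⟨ipExpQ_eq_ipExp_of_tables e2m1_nonempty hA hP e2m1_pairs_dyadic_two hs n f,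
    ipExpQ_eq_ipExp_of_tables e2m1_nonempty hB hP e2m1_pairs_dyadic_two hs n f,
    ipExpQ_eq_ipExp_of_tables e2m1_nonempty hC hP e2m1_pairs_dyadic_two hs n f⟩

/-- The same for format vectors `x`, `y` (products `xₖyₖ`). -/
theorem e2m1_twoBits_ip_exact' {N : ℕ} (hN : 2 ≤ N) {x y : ℕ → ℚ} (hx : ∀ k, x k ∈ e2m1)
    (hy : ∀ k, y k ∈ e2m1) {s : ℚ} (hs : s ∈ e2m1) (n : ℕ) (f : ℚ → ℚ) :
    ipExpQ e2m1 (probAwayA N) (fun k => x k * y k) n f s = ipExp e2m1 (fun k => x k * y k) n f s ∧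
    ipExpQ e2m1 (probAwayB N) (fun k => x k * y k) n f s = ipExp e2m1 (fun k => x k * y k) n f s ∧
    ipExpQ e2m1 (probAwayC N) (fun k => x k * y k) n f s = ipExp e2m1 (fun k => x k * y k) n f s :=
  e2m1_twoBits_ip_exact hN (fun k => mul_mem_e2m1Products (hx k) (hy k)) hs n f

/-- **Sharpness of two (two-stage): one bit is biased.** Product `9/4` accumulated onto `0`: the exact
two-stage mean is `9/4`; with ONE bit `StochasticA` and `C` never round `9/4` up (mean `2`) and `B`
rounds it up with probability `½` (mean `5/2`). -/
theorem e2m1_oneBit_ip_witness :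
    ipExp e2m1 (fun _ => (9/4 : ℚ)) 1 id 0 = 9/4 ∧
    ipExpQ e2m1 (probAwayA 1) (fun _ => (9/4 : ℚ)) 1 id 0 = 2 ∧
    ipExpQ e2m1 (probAwayB 1) (fun _ => (9/4 : ℚ)) 1 id 0 = 5/2 ∧
    ipExpQ e2m1 (probAwayC 1) (fun _ => (9/4 : ℚ)) 1 id 0 = 2 := by
  refine ⟨by decide +kernel, by decide +kernel, by decide +kernel, by decide +kernel⟩

/-- **PAIR TABLE OVER PRODUCTS (37² = 1369 entries, kernel decision).** Every sum of two products of
E2M1 values has a 3-dyadic up-probability in E2M1; `4 + ¼` (`θ = ⅛`) is not 2-dyadic. -/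
theorem e2m1Products_pairs_dyadic_three :
    (∀ a ∈ e2m1Products, ∀ b ∈ e2m1Products, Dyadic 3 (pUp e2m1 (a + b))) ∧
    ¬ Dyadic 2 (pUp e2m1 ((4 : ℚ) + 1/4)) := by
  refine ⟨by decide +kernel, by decide +kernel⟩

/-- **Three random bits reproduce exact SR on every FP4 dot-product tree**: every summation tree whose
leaves are exact products of E2M1 values (or E2M1 values), in any order, is exact in law under
`StochasticA/B/C` with `N ≥ 3` bits, for every test function. -/
theorem e2m1_threeBits_dotTree_exact {N : ℕ} (hN : 3 ≤ N) (T : STree ℚ)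
    (hT : LeavesIn e2m1Products T) (f : ℚ → ℚ) :
    treeExpQ e2m1 (probAwayA N) T f = treeExp e2m1 T f ∧
    treeExpQ e2m1 (probAwayB N) T f = treeExp e2m1 T f ∧
    treeExpQ e2m1 (probAwayC N) T f = treeExp e2m1 T f := by
  obtain ⟨hA, hB, hC⟩ := probAwayABC_of_dyadic_le (K := ℚ) hN
  exact ⟨treeExpQ_eq_treeExp_of_pairs_sup e2m1_nonempty e2m1_subset_products hA
      e2m1Products_pairs_dyadic_three.1 T hT f,
    treeExpQ_eq_treeExp_of_pairs_sup e2m1_nonempty e2m1_subset_products hB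
      e2m1Products_pairs_dyadic_three.1 T hT f,
    treeExpQ_eq_treeExp_of_pairs_sup e2m1_nonempty e2m1_subset_products hC
      e2m1Products_pairs_dyadic_three.1 T hT f⟩

/-- **Three bits reproduce the exact one-stage FP4 inner product** `ŝₖ₊₁ = SR(ŝₖ + xₖyₖ)` in law, for
every length, every E2M1 start and every test function. -/
theorem e2m1_threeBits_ip1_exact {N : ℕ} (hN : 3 ≤ N) {c : ℕ → ℚ} (hc : ∀ k, c k ∈ e2m1Products)
    {s : ℚ} (hs : s ∈ e2m1) (n : ℕ) (f : ℚ → ℚ) :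
    accExpQ e2m1 (probAwayA N) c n f s = accExp e2m1 c n f s ∧
    accExpQ e2m1 (probAwayB N) c n f s = accExp e2m1 c n f s ∧
    accExpQ e2m1 (probAwayC N) c n f s = accExp e2m1 c n f s := by
  obtain ⟨hA, hB, hC⟩ := probAwayABC_of_dyadic_le (K := ℚ) hN
  have hT : ∀ s ∈ e2m1, ∀ p ∈ e2m1Products, Dyadic 3 (pUp e2m1 (s + p)) :=
    fun s hs p hp => e2m1Products_pairs_dyadic_three.1 s (e2m1_subset_products hs) p hp
  exact ⟨accExpQ_eq_accExp_of_table e2m1_nonempty hA hc hT hs n f,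
    accExpQ_eq_accExp_of_table e2m1_nonempty hB hc hT hs n f,
    accExpQ_eq_accExp_of_table e2m1_nonempty hC hc hT hs n f⟩

/-- **Sharpness of three (one-stage): two bits are biased.** Product `¼ = ½·½` accumulated onto `4`:
exact mean `17/4`; with TWO bits `A` and `C` never round up (mean `4`), `B` rounds up with probability
`¼` (mean `9/2`). -/
theorem e2m1_twoBits_ip1_witness :
    accExp e2m1 (fun _ => (1/4 : ℚ)) 1 id 4 = 17/4 ∧
    accExpQ e2m1 (probAwayA 2) (fun _ => (1/4 : ℚ)) 1 id 4 = 4 ∧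
    accExpQ e2m1 (probAwayB 2) (fun _ => (1/4 : ℚ)) 1 id 4 = 9/2 ∧
    accExpQ e2m1 (probAwayC 2) (fun _ => (1/4 : ℚ)) 1 id 4 = 4 := by
  refine ⟨by decide +kernel, by decide +kernel, by decide +kernel, by decide +kernel⟩

/-- **… while the two-stage model is exact at the same data with two bits**: rounding `¼` first (to `0`
or `½`, an exact coin) and then accumulating meets only 2-dyadic probabilities: all three rules give
the exact two-stage mean `17/4`.  Rounding the product first LOWERS the exactness threshold. -/
theorem e2m1_twoBits_ip2_at_witness :
    ipExp e2m1 (fun _ => (1/4 : ℚ)) 1 id 4 = 17/4 ∧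
    ipExpQ e2m1 (probAwayA 2) (fun _ => (1/4 : ℚ)) 1 id 4 = 17/4 ∧
    ipExpQ e2m1 (probAwayB 2) (fun _ => (1/4 : ℚ)) 1 id 4 = 17/4 ∧
    ipExpQ e2m1 (probAwayC 2) (fun _ => (1/4 : ℚ)) 1 id 4 = 17/4 := by
  refine ⟨by decide +kernel, by decide +kernel, by decide +kernel, by decide +kernel⟩

end FP4Thresholds

/-! ### FP6 lower-bound witnesses (the full tables are the HOME certificate `certs/sr/gen15/ipthr`) -/

section FP6Witnesses

open Formats

/-- E3M2: the one-stage inner product needs TEN random bits (`-28 + 1/256`, `1/256 = (1/16)²`, sits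
`1/1024` into the width-4 top cell) and ten suffice there; product rounding needs four
(`-49/256 = -(7/16)²`). -/
theorem e3m2_ip_threshold_witnesses :
    ¬ Dyadic 9 (pUp e3m2 ((-28 : ℚ) + 1/256)) ∧ Dyadic 10 (pUp e3m2 ((-28 : ℚ) + 1/256)) ∧
    ¬ Dyadic 3 (pUp e3m2 (-49/256 : ℚ)) ∧ Dyadic 4 (pUp e3m2 (-49/256 : ℚ)) := by
  refine ⟨by decide +kernel, by decide +kernel, by decide +kernel, by decide +kernel⟩

/-- E2M3: the one-stage inner product needs FIVE random bits (`-15/2 + 1/64`, `1/64 = (1/8)²`) and five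
suffice there; product rounding needs four (`-225/32 = -(15/4)·(15/8)` sits `15/16` into its
cell). -/
theorem e2m3_ip_threshold_witnesses :
    ¬ Dyadic 4 (pUp e2m3 ((-15/2 : ℚ) + 1/64)) ∧ Dyadic 5 (pUp e2m3 ((-15/2 : ℚ) + 1/64)) ∧
    ¬ Dyadic 3 (pUp e2m3 (-225/32 : ℚ)) ∧ Dyadic 4 (pUp e2m3 (-225/32 : ℚ)) := by
  refine ⟨by decide +kernel, by decide +kernel, by decide +kernel, by decide +kernel⟩

end FP6Witnesses

end Summit.Ventures.CertifiedArithmetic.LowPrec.SR.LimitedBits
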